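import Literature.AnabelianGeometry.SemiGraphs.TemperedSpecialFibreTowerPiDataNonVacuity
import HarnessLib

/-!
# Non-vacuity of `SpecialFibreTower.PiData` / `FiniteLevels` WITH THE FIBRES EXPOSED
# ([SemiAnbd] Ex. 3.10 pp. 44–45 / [IUTchI] §2 pp. 44–50), generic form

Mochizuki, *Semi-graphs of anabelioids*, Publ. RIMS **42** (2006), §3, Example 3.10, manuscript p. 44
[cite: MochizukiSemiAnbd2006, Ex 3.10 p.44] ("an exhaustive sequence of open characteristic … subgroups … `N_i` …
semi-graphs of anabelioids `𝒢_i`, `𝒢^c_i` on which `Δ_i` acts faithfully"); S. Mochizuki, *Inter-universal Teichmüller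
theory I*, §2 p. 44, Cor. 2.3 (vi) p. 48, proof of Prop. 2.4 (i) p. 50 [cite: Mochizuki2012, Prop 2.4(i) p.50] (D-0012
claim key; nothing of the series is asserted here) — the ORIGIN-DATA records `SpecialFibreTower.FiniteLevels X d S T`
and `SpecialFibreTower.PiData X d S T` of seat abc-iut-L3-t2 (`TemperedSpecialFibreTowerPiData.lean`).

PROOF-ONLY file (abc-iut cell, layer L3, seat abc-iut-L3-t3 gen 8, row «PIDATA-EXPOSED» = abc-iut-L3-lead γ3
2026-08-26T22:09:49Z answering abc-iut-L5-lead INTERFACE QUESTION (Q1) 21:39:46Z; no definition, no instance, no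
notation, no named `Prop` fact; the frozen records are imported, never restated).

WHY.  Seat abc-iut-L3-t2's generic builder `SpecialFibreTower.PiData.nonempty_of_charLevels`
(`TemperedSpecialFibreTowerPiDataNonVacuity.lean`) concludes `∃ S T, T.N = N ∧ (∀ i, T.admKer i = ⊥) ∧
S.admissible.ker = ⊥ ∧ FiniteLevels X d S T ∧ Nonempty (PiData X d S T)` — OPAQUE on the fibres: after `obtain` the
level semi-graphs of anabelioids `T.Gc i` / the base `S.Gc` and their tempered fundamental group charts are abstract,
so the per-level identification binders of the [IUTchI] §2 one-call of record (abc-iut-L5-t11's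
`prop24_cor25_ofPiData_byName_noRF`: `σ_i : (T.Gc i).graph.Vertex ≃ …`, `hvert : Λv i (σ i v) ∈
verticialSubgroups (T.chart i) v`, and the `v = w` disjunct of `hNN_i` needing a SUBSINGLETON vertex type) cannot be
inhabited from it (abc-iut-L5-t11 gen 8 diagnosis (D1), STATUS 2026-08-26T21:26:11Z).  This file RE-RUNS t2's
construction verbatim — base fibre `𝒢^c := B(Δ^temp)` = seat abc-iut-L3-t2's one-vertex edgeless witness
`OneVertex.graph` with the explicit chart `OneVertex.chart` (`π₁^temp = Δ^temp` on the nose), tower fibres `B(N_i)`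
with charts `π₁^temp = N_i`, admissible kernels `1`, trivial graph actions, identity projections, `ℍ := 𝔾^c`,
`Π^tp_ℍ := ⊤` — and EXPORTS, besides t2's five conjuncts, the shape of the fibres:

* (E1) every `T.Gc i` and `S.Gc` has exactly ONE vertex (`Nonempty (Unique …Vertex)`), NO edges and NO branches;
* (E2) the whole chart group is a verticial subgroup at every vertex — `⊤ ∈ verticialSubgroups (T.chart i) v`,
  `⊤ ∈ verticialSubgroups S.chart v` (abc-iut-L3-t2's `OneVertex.top_mem_verticialSubgroups`) — and in fact the ONLY
  one: `verticialSubgroups (T.chart i) v = {⊤}`, `verticialSubgroups S.chart v = {⊤}` (abc-iut-L3-t2's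
  `OneVertex.verticialSubgroups_chart_eq`: every verticial homomorphism of the explicit chart is inner, Prop. 3.2).

(The chart groups themselves are identified chart-free by the record: `T.adm i : N_i →ₜ* (T.chart i).G` is a
continuous open surjection with kernel `T.admKer i = 1`, and `S.admissible` likewise with kernel `1`.)
Consumers (abc-iut-f-193's cusped builder `PiData.exists_temperedCurve_of_charLevels_cusped`, then the L5 §2 one-call
non-vacuity) swap ONE call and take `Λv := ⊤`.

HONEST LIMITS (t2's, carried verbatim): consistency evidence for the field set only — one-vertex fibres, profinite
`Δ^temp` (a genuine tempered `Δ^temp_X` is not profinite), trivial graph actions; NOT the special-fibre tower of a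
curve; no origin certificate is claimed.  Nothing of the papers is asserted; no side is taken on [IUTchIII] Cor. 3.12;
typed ≠ inhabited ≠ discharged.
-/

noncomputable section

namespace Literature.AnabelianGeometry.SemiGraphs

open Literature.AlgebraicGeometry.Frobenioids (IsSlimGroup)
open ProfiniteSemiGraph Topology Filter CategoryTheory

universe u

/-! ### Small group-theoretic facts (private; as in the parent file, where they are private too) -/

/-- Open subgroups of slim groups are slim. [cite: MochizukiSemiAnbd2006, §0 p.6] -/
private theorem isSlimGroup_subgroup_exposedAux {G : Type u} [Group G] [TopologicalSpace G] [ContinuousMul G]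
    (hG : IsSlimGroup G) (H : Subgroup G) (hH : IsOpen (H : Set G)) : IsSlimGroup H := by
  refine ⟨fun U hU => ?_⟩
  have hUo : IsOpen ((U.map H.subtype : Subgroup G) : Set G) := by
    have : ((U.map H.subtype : Subgroup G) : Set G) = Subtype.val '' (U : Set H) := by
      ext x; simp
    rw [this]
    exact hH.isOpenMap_subtype_val _ hU
  have hc := hG.centralizer_eq_bot _ hUo
  refine (Subgroup.eq_bot_iff_forall _).mpr fun c hc' => ?_
  have hcG : (c : G) ∈ Subgroup.centralizer ((U.map H.subtype : Subgroup G) : Set G) := by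
    rw [Subgroup.mem_centralizer_iff]
    rintro _ ⟨u, hu, rfl⟩
    exact congrArg Subtype.val (Subgroup.mem_centralizer_iff.mp hc' u hu)
  rw [hc] at hcG
  exact Subtype.ext (Subgroup.mem_bot.mp hcG)

/-- A subgroup of finite index of an infinite group is infinite. [folklore] -/
private theorem infinite_of_finiteIndex_exposedAux {G : Type u} [Group G] [Infinite G] (H : Subgroup G)
    [H.FiniteIndex] : Infinite H := by
  by_contra hfin
  rw [not_infinite_iff_finite] at hfin
  have hcard : Nat.card G = H.index * Nat.card H := (Subgroup.index_mul_card H).symm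
  have hne : Nat.card G ≠ 0 := by
    rw [hcard]
    exact mul_ne_zero Subgroup.FiniteIndex.index_ne_zero (Nat.card_pos (α := H)).ne'
  haveI := Nat.finite_of_card_ne_zero hne
  exact not_finite G

/-- An open subgroup of a compact group is compact. [folklore] -/
private theorem compactSpace_subgroup_exposedAux {G : Type u} [Group G] [TopologicalSpace G] [ContinuousMul G]
    [CompactSpace G] (H : Subgroup G) (hH : IsOpen (H : Set G)) : CompactSpace H :=
  isCompact_iff_compactSpace.mp (H.isClosed_of_isOpen hH).isCompact

/-- In a profinite group a family cofinal among the open NORMAL subgroups of finite index is exhaustive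
("an exhaustive sequence of open … subgroups of finite index", [SemiAnbd] Ex. 3.10 p. 44 l. 9).
[cite: MochizukiSemiAnbd2006, Ex 3.10 p.44] -/
private theorem eq_one_of_forall_mem_of_cofinal_normal_exposedAux {Δ : Type u} [Group Δ] [TopologicalSpace Δ]
    [IsTopologicalGroup Δ] [CompactSpace Δ] [TotallyDisconnectedSpace Δ] (N : ℕ → Subgroup Δ)
    (hcof : ∀ U : Subgroup Δ, IsOpen (U : Set Δ) → U.Normal → U.FiniteIndex → ∃ i, N i ≤ U) (g : Δ)
    (hg : ∀ i, g ∈ N i) : g = 1 := by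
  by_contra hne
  obtain ⟨H, hH⟩ := ProfiniteGrp.exist_openNormalSubgroup_sub_open_nhds_of_one
    (isOpen_compl_singleton (x := g)) (by simpa using fun h : (1 : Δ) = g => hne h.symm)
  haveI : Finite (Δ ⧸ H.toSubgroup) := Subgroup.quotient_finite_of_isOpen _ H.isOpen
  haveI : H.toSubgroup.FiniteIndex := Subgroup.finiteIndex_of_finite_quotient
  obtain ⟨i, hi⟩ := hcof H.toSubgroup H.isOpen inferInstance inferInstance
  exact hH (hi (hg i)) rfl

/-! ### The witness, fibres exposed -/

namespace SpecialFibreTower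

variable {p : ℕ} [Fact p.Prime]

/-- **NON-VACUITY of `SpecialFibreTower.FiniteLevels` and `SpecialFibreTower.PiData` WITH THE FIBRES EXPOSED**
([SemiAnbd] Ex. 3.10 pp. 44–45 / [IUTchI] §2 as typed in `TemperedSpecialFibreTowerPiData.lean`; seat
abc-iut-L3-t2's `PiData.nonempty_of_charLevels` with its construction's shape exported): for every §6 datum
`X : TemperedCurve p` with `d : X.GroupLevelData`, profinite `Π^temp` and infinite `Δ^temp` carrying an antitone family
`N` of open normal finite-index subgroups stable under all automorphisms of the topological group `Δ^temp` and cofinal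
among the open normal subgroups of finite index, there are special-fibre data `S` (base fibre `B(Δ^temp)`, admissible
quotient the identity) and a special-fibre tower `T` WITH LEVELS `N` (fibres `B(N_i)`, charts `π₁^temp = N_i`,
admissible kernels `1`) such that `FiniteLevels X d S T` holds, `PiData X d S T` is INHABITED, and moreover
(E1) every fibre `T.Gc i` and the base `S.Gc` has exactly one vertex, no edges and no branches, and
(E2) at every vertex the whole chart group is a verticial subgroup and the only one:
`verticialSubgroups (T.chart i) v = {⊤}`, `verticialSubgroups S.chart v = {⊤}`.
Consistency evidence for the 25 fields only; not the tower of a curve. [cite: MochizukiSemiAnbd2006, Ex 3.10 p.44] -/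
theorem PiData.nonempty_of_charLevels_exposed (X : TemperedCurve p) (d : X.GroupLevelData) [CompactSpace X.PiTemp]
    [TotallyDisconnectedSpace X.PiTemp] (hinf : Infinite X.DeltaTemp) (N : ℕ → Subgroup X.DeltaTemp)
    (hanti : Antitone N) (hopen : ∀ i, IsOpen (N i : Set X.DeltaTemp))
    (hchar : ∀ (i) (φ : X.DeltaTemp ≃ₜ* X.DeltaTemp), (N i).map φ.toMulEquiv.toMonoidHom = N i)
    (hnormal : ∀ i, (N i).Normal) (hfi : ∀ i, (N i).FiniteIndex)
    (hcof : ∀ U : Subgroup X.DeltaTemp, IsOpen (U : Set X.DeltaTemp) → U.Normal → U.FiniteIndex → ∃ i, N i ≤ U) :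
    ∃ (S : SpecialFibreData (X.toTemperedArithmeticGroup d)) (T : SpecialFibreTower X.DeltaTemp),
      T.N = N ∧ (∀ i, T.admKer i = ⊥) ∧ S.admissible.toMonoidHom.ker = ⊥ ∧
        FiniteLevels X d S T ∧ Nonempty (PiData X d S T) ∧
        -- (E1) the fibres and the base are one-vertex, edgeless, branchless semi-graphs of anabelioids
        (∀ i, Nonempty (Unique (T.Gc i).graph.Vertex)) ∧ (∀ i, IsEmpty (T.Gc i).graph.Edge) ∧
        (∀ i, IsEmpty (T.Gc i).graph.Branch) ∧
        Nonempty (Unique S.Gc.graph.Vertex) ∧ IsEmpty S.Gc.graph.Edge ∧ IsEmpty S.Gc.graph.Branch ∧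
        -- (E2) the whole chart group is a verticial subgroup at every vertex …
        (∀ i v, (⊤ : Subgroup (T.chart i).G) ∈ verticialSubgroups (T.chart i) v) ∧
        (∀ v, (⊤ : Subgroup S.chart.G) ∈ verticialSubgroups S.chart v) ∧
        -- … and the only one
        (∀ i v, verticialSubgroups (T.chart i) v = {⊤}) ∧
        (∀ v, verticialSubgroups S.chart v = {⊤}) := by
  classical
  -- topological bookkeeping: `Δ^temp = Ker(aug)` is a closed, hence profinite, subgroup of the profinite `Π^temp`
  haveI : IsGalois ℚ_[p] (AlgebraicClosure ℚ_[p]) := {}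
  haveI : T2Space (GQp p) := krullTopology_t2
  haveI : SecondCountableTopology X.PiTemp := d.secondCountableTopology
  have hΔclosed : IsClosed (X.DeltaTemp : Set X.PiTemp) := by
    have : (X.DeltaTemp : Set X.PiTemp) = X.aug ⁻¹' {1} := by
      ext g; exact MonoidHom.mem_ker
    rw [this]; exact isClosed_singleton.preimage X.aug.continuous
  haveI hΔcpt : CompactSpace X.DeltaTemp := isCompact_iff_compactSpace.mp hΔclosed.isCompact
  haveI hΔsc : SecondCountableTopology X.DeltaTemp := TopologicalSpace.Subtype.secondCountableTopology _
  haveI := hinf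
  -- slimness of `Δ^temp` (from the parameter bundle: `Ker(augK) = Δ^temp`)
  have hslimΔ : IsSlimGroup X.DeltaTemp := by
    have h := d.isSlimGroup_ker
    rwa [TemperedCurve.ker_augK] at h
  have hexh : ∀ g : X.DeltaTemp, (∀ i, g ∈ N i) → g = 1 :=
    eq_one_of_forall_mem_of_cofinal_normal_exposedAux N hcof
  -- the levels as profinite groups with level families
  haveI hcpt : ∀ i : ℕ, CompactSpace (N i) := fun i => compactSpace_subgroup_exposedAux (N i) (hopen i)
  haveI hsc : ∀ i : ℕ, SecondCountableTopology (N i) :=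
    fun i => TopologicalSpace.Subtype.secondCountableTopology _
  haveI hinfN : ∀ i : ℕ, Infinite (N i) := fun i => infinite_of_finiteIndex_exposedAux (N i)
  have hslimN : ∀ i : ℕ, IsSlimGroup (N i) := fun i => isSlimGroup_subgroup_exposedAux hslimΔ (N i) (hopen i)
  have L : ∀ i : ℕ, ProfiniteSemiGraph.LevelFamily (N i) :=
    fun i => Classical.choice (ProfiniteSemiGraph.LevelFamily.nonempty_of_infinite (N i))
  have L₀ : ProfiniteSemiGraph.LevelFamily X.DeltaTemp :=
    Classical.choice (ProfiniteSemiGraph.LevelFamily.nonempty_of_infinite X.DeltaTemp)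
  -- the group-level datum `D` and its `Δ = Ker(augK)`, equal to `Δ^temp`
  let D := X.toTemperedArithmeticGroup d
  have hδ : D.delta = X.DeltaTemp := X.toTemperedArithmeticGroup_delta d
  -- the admissible quotient of the base: the identity `Δ ⥲ Δ^temp`
  let adm₀ : D.delta →ₜ* X.DeltaTemp :=
    { toMonoidHom := Subgroup.inclusion hδ.le
      continuous_toFun := continuous_inclusion hδ.le }
  have hadm₀_surj : Function.Surjective adm₀ := fun y => ⟨⟨y.1, hδ.ge y.2⟩, rfl⟩
  have hadm₀_ker : adm₀.toMonoidHom.ker = ⊥ :=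
    (MonoidHom.ker_eq_bot_iff _).mpr (Subgroup.inclusion_injective hδ.le)
  -- the special-fibre data of the base: `𝒢^c := B(Δ^temp)`
  let S : SpecialFibreData D :=
    { Gc := OneVertex.graph X.DeltaTemp
      hyp := OneVertex.thm37Hypotheses L₀ hslimΔ
      chart := OneVertex.chart L₀
      admissible := adm₀
      admissible_surjective := hadm₀_surj }
  -- the tower: levels `N_i`, fibres `B(N_i)`, admissible kernels `1`
  let T : SpecialFibreTower X.DeltaTemp :=
    { N := N
      N_antitone := hanti
      isOpen_N := hopen
      N_char := hchar
      N_normal := hnormal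
      N_finiteIndex := hfi
      N_exhaustive := hexh
      Gc := fun i => OneVertex.graph (N i)
      hyp := fun i => OneVertex.thm37Hypotheses (L i) (hslimN i)
      chart := fun i => OneVertex.chart (L i)
      admKer := fun _ => ⊥
      admKer_le := fun _ => bot_le
      admKer_normal := fun _ => inferInstance
      admKer_antitone := fun _ _ _ => le_rfl
      adm := fun i => ContinuousMonoidHom.id _
      adm_surjective := fun i => Function.surjective_id
      isOpenMap_adm := fun i => IsOpenMap.id
      ker_adm := fun i => by
        rw [Subgroup.bot_subgroupOf]
        exact (MonoidHom.ker_eq_bot_iff _).mpr Function.injective_id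
      faithful := fun i g hg => by
        have hz : g ∈ Subgroup.centralizer (N i : Set X.DeltaTemp) := by
          rw [Subgroup.mem_centralizer_iff]
          intro n hn
          have h := hg n hn
          rw [Subgroup.mem_bot] at h
          have : g * n = n * g := by
            calc g * n = g * n * g⁻¹ * n⁻¹ * (n * g) := by group
              _ = n * g := by rw [h, one_mul]
          exact this.symm
        rw [hslimΔ.centralizer_eq_bot _ (hopen i), Subgroup.mem_bot] at hz
        rw [hz]; exact (N i).one_mem }
  have hS_ker : S.admissible.toMonoidHom.ker = ⊥ := hadm₀_ker
  -- finiteness of the (one-vertex, edgeless) fibres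
  have hF : FiniteLevels X d S T :=
    { finite_vertex_base := by show Finite PUnit; infer_instance
      finite_edge_base := by show Finite PEmpty; infer_instance
      finite_vertex := fun i => by show Finite PUnit; infer_instance
      finite_edge := fun i => by show Finite PEmpty; infer_instance }
  -- one-vertex fibres: the vertex types are `PUnit`
  have hsubT : ∀ i, Subsingleton (T.Gc i).graph.Vertex := fun _ => (inferInstance : Subsingleton PUnit)
  have hsubS : Subsingleton S.Gc.graph.Vertex := (inferInstance : Subsingleton PUnit)
  -- the sub-semi-graph `ℍ := 𝔾^c` (everything) is connected
  let H : S.Gc.graph.Subgraph := ⟨Set.univ, Set.univ⟩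
  have hsubH : Subsingleton H.toSemiGraph.Vertex :=
    ⟨fun a b => Subtype.ext (@Subsingleton.elim _ hsubS _ _)⟩
  have hHconn : H.toSemiGraph.IsConnected := by
    refine ⟨@SimpleGraph.Connected.mk _ _ ?_ ⟨Sum.inl ⟨PUnit.unit, Set.mem_univ _⟩⟩⟩
    intro a b
    have hab : a = b := by
      rcases a with a | a | a
      · rcases b with b | b | b
        · exact congrArg Sum.inl (@Subsingleton.elim _ hsubH _ _)
        · exact b.1.elim
        · exact b.1.elim
      · exact a.1.elim
      · exact a.1.elim
    subst hab
    exact SimpleGraph.Reachable.refl _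
  -- the `PiData` inhabitant (t2's, verbatim)
  have hP : Nonempty (PiData X d S T) := by
    refine ⟨?_⟩
    exact
      { admKer_normal_pi := fun i => by
          show ((⊥ : Subgroup X.DeltaTemp).map X.DeltaTemp.subtype).Normal
          rw [Subgroup.map_bot]; infer_instance
        admissibleKer_normal_pi := by
          rw [hS_ker, Subgroup.map_bot]; infer_instance
        N_cofinal := hcof
        finite := hF
        actGraph := fun _ => 1
        actGraph₀ := 1
        actGraph_vertexMap := fun i _ _ _ => @Subsingleton.elim _ (hsubT i) _ _
        actGraph₀_vertexMap := fun _ _ _ => @Subsingleton.elim _ hsubS _ _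
        proj := fun _ => 𝟙 _
        proj_vertex_surjective := fun _ => Function.surjective_id
        proj_actGraph := fun _ _ => rfl
        H := H
        H_connected := hHconn
        H_stable := fun _ => ⟨fun _ _ => Set.mem_univ _, fun _ _ => Set.mem_univ _⟩
        TpH := ⊤
        TpH_verticial := fun v _ => ⟨⊤, OneVertex.top_mem_verticialSubgroups L₀ v, le_rfl⟩
        TpH_le := by
          intro x _
          apply Subgroup.le_topologicalClosure
          apply Subgroup.subset_closure
          refine Set.mem_iUnion₂.mpr ⟨PUnit.unit, Set.mem_univ _, ?_⟩
          exact Set.mem_iUnion₂.mpr ⟨⊤, OneVertex.top_mem_verticialSubgroups L₀ _, Subgroup.mem_top x⟩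
        baseVertex := PUnit.unit
        baseVertex_mem := Set.mem_univ _
        baseLift := fun _ => PUnit.unit
        proj_baseLift := fun _ => rfl
        vtxOfCusp := fun _ _ => PUnit.unit
        proj_vtxOfCusp := fun _ _ _ => rfl
        inertia_le_verticial := fun i x =>
          ⟨⊤, OneVertex.top_mem_verticialSubgroups (L i) _, le_top⟩ }
  refine ⟨S, T, rfl, fun _ => rfl, hS_ker, hF, hP, ?_, ?_, ?_, ?_, ?_, ?_, ?_, ?_, ?_, ?_⟩
  -- (E1) tower fibres: one vertex (`PUnit`), no edges, no branches (`PEmpty`)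
  · exact fun _ => ⟨(inferInstance : Unique PUnit)⟩
  · exact fun _ => (inferInstance : IsEmpty PEmpty)
  · exact fun _ => (inferInstance : IsEmpty PEmpty)
  -- (E1) base fibre
  · exact ⟨(inferInstance : Unique PUnit)⟩
  · exact (inferInstance : IsEmpty PEmpty)
  · exact (inferInstance : IsEmpty PEmpty)
  -- (E2) `⊤` is verticial (explicit charts `π₁^temp = N_i`, `π₁^temp = Δ^temp`)
  · exact fun i v => OneVertex.top_mem_verticialSubgroups (L i) v
  · exact fun v => OneVertex.top_mem_verticialSubgroups L₀ v
  -- (E2) and the only verticial subgroup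
  · exact fun i v => OneVertex.verticialSubgroups_chart_eq (L i) v
  · exact fun v => OneVertex.verticialSubgroups_chart_eq L₀ v

end SpecialFibreTower

end Literature.AnabelianGeometry.SemiGraphs

end
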